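import Literature.MathematicalPhysics.QuantumLattice.HubbardFreePropagatorTimePeriodization
import Literature.Probability.LatticeModels.PeriodizedDecay
import HarnessLib

/-!
# Uniform decay of the free Hubbard propagator: in the time separation and in the volume

Topic `MathematicalPhysics/QuantumLattice`; programme under the tree's fact `bgm_two_point_limit`
(`HubbardFermiLiquid.lean`, Benfatto–Giuliani–Mastropietro 2006, Thm. 1.1). Combines
`HubbardFreePropagatorPeriodization.lean` / `HubbardFreePropagatorTimePeriodization.lean` (for
`L ≥ 3` the `U = 0` torus two-point function at complex times `t, s` is the sum over images
`Σ_{n ∈ ℤ²} g(s - t, y - x + Ln)` of the infinite-volume imaginary-time free propagator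
`g = freePropagatorInfiniteTime β μ`, smooth symbol, every-order decay at fixed time) with
`Literature.Probability.LatticeModels.PeriodizedDecay` (a sum over images of a kernel decaying like
`(1 + |x|)^{-K}` decays like `(1 + |z|)^{-K}` in the torus distance, uniformly in the period) and
the uniform-in-time decay of Fourier coefficients of jointly smooth space–time families on `𝕋^d`
(`Literature.Analysis.FluidPDE.ScalarFourier.exists_hasDecay_mFourierCoeff_spaceTime`). PROVED:

* `isSmoothSpaceTimeOn_hubbardFreeSymbolTime` — `(τ, t) ↦ e^{-τE(t)} f_β(E(t))` is jointly smooth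
  for real `τ` (indeed entire in `τ`);
* **uniform decay in the time separation** (`exists_uniform_decay_freePropagatorInfiniteTime`):
  for every `T > 0` and `K`, `|g(τ, z)| ≤ C (1 + |z|)^{-K}` for ALL real `τ ∈ [0, T]` and
  `z ∈ ℤ^d`, with one constant `C = C(β, μ, T, K)`;
* **uniform decay in the volume** (`exists_norm_hubbardThermalTwoPointEvolved_zero_interaction_le`):
  for every `β, μ, T > 0`, `K ≥ 4` there is `C` such that for ALL `L ≥ 3`, real times `t, s`
  with `0 ≤ s - t ≤ T`, sites `x, y`, spins `σ, σ'`, and every representative `z ≡ y - x (mod L)`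
  with `2|z| ≤ L` (e.g. the centred one, `|z|` = torus distance):
  `|⟨a⁺_{xσ}(t) a⁻_{yσ'}(s)⟩_{β,L,U=0}| ≤ C (1 + |z|)^{-K}`; the equal-time case
  `exists_norm_hubbardThermalTwoPoint_zero_interaction_le`;
* the same for time separations in an ARBITRARY compact interval `[a, b]` (negative separations
  occur in the perturbative coefficients, where the creation time is the later one):
  `exists_uniform_decay_freePropagatorInfiniteTime_Icc`,
  `exists_norm_hubbardThermalTwoPointEvolved_zero_interaction_le_of_Icc` (and the primed intrinsic
  form, which also supplies the short representative, `exists_representative_two_mul_norm_le`).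

This is the free-propagator instance of the uniformity in `L` that BGM invoke (§2.2, footnote 1:
"our bounds can be adapted also to the finite `L` case, and the resulting estimates turn out to be
uniform in `L`"; the single-scale bounds (2.48)–(2.50) are `N`-arbitrary power laws), together
with the uniformity in the imaginary-time separation over `[0, T]` needed to integrate over times.

Everything is PROVED; no definition.

## References

* G. Benfatto, A. Giuliani, V. Mastropietro, Ann. Henri Poincaré 7 (2006) 809–898, §2.2
  footnote 1 and (2.48)–(2.50) (arXiv:cond-mat/0507686 pp. 8, 11). [BenfattoGiulianiMastropietro2006]
* J. Glimm, A. Jaffe, *Quantum Physics*, 2nd ed. (1987), §7.3 (estimates from the sum over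
  images). [GlimmJaffeQP1987]
-/

noncomputable section

open Filter Set UnitAddTorus
open scoped Topology ContDiff
open Literature.Probability.LatticeModels
open Literature.Analysis.FunctionSpaces.Torus (IsSmoothSpaceTimeOn)

namespace Literature.MathematicalPhysics.QuantumLattice

variable {d : ℕ}

/-! ### Bookkeeping: classes mod `L`, lattice weights -/

/-- **The sum over images depends only on the class mod `L`**: if `z' = z + Lm` then
`Σ_n a(z' + Ln) = Σ_n a(z + Ln)`. [folklore] -/
theorem tsum_translate_eq_of_eq_add_zsmul {a : Site d → ℂ} (L : ℕ) {z z' : Site d} (m : Site d)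
    (h : z' = z + (L : ℤ) • m) :
    ∑' n : Site d, a (z' + (L : ℤ) • n) = ∑' n : Site d, a (z + (L : ℤ) • n) := by
  subst h
  rw [← (Equiv.addLeft m).tsum_eq (fun n => a (z + (L : ℤ) • n))]
  refine tsum_congr fun n => ?_
  simp only [Equiv.coe_addLeft, smul_add, add_assoc]

/-- The lattice weights `(1 + |n|)^{-K}` are summable over `ℤ^d` for `K ≥ 2d` (the tree's
`ScalarFourier.summable_latWeight`). [folklore] -/
theorem summable_inv_one_add_norm_pow {K : ℕ} (hK : 2 * d ≤ K) :
    Summable fun n : Site d => ((1 + ‖n‖) ^ K)⁻¹ := by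
  have h := Literature.Analysis.FluidPDE.ScalarFourier.summable_latWeight (d := Fin d)
  have hlo : Literature.Analysis.FluidPDE.ScalarFourier.latOrder (Fin d) = 2 * d := by
    rw [Literature.Analysis.FluidPDE.ScalarFourier.latOrder, Fintype.card_fin]
  rw [hlo] at h
  refine Summable.of_nonneg_of_le (fun n => by positivity) (fun n => ?_) h
  exact inv_anti₀ (by positivity) (pow_le_pow_right₀ (by linarith [norm_nonneg n]) hK)

/-! ### Uniform decay in the imaginary-time separation -/

section Time

variable (β μ : ℝ)

/-- **The free symbol is jointly smooth in (real) time and momentum**: the space–time lift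
`(τ, y) ↦ e^{-τ E(y)} f_β(E(y))`, `E(y) = -2Σcos 2πyᵢ - μ`, is `C^∞` on `ℝ × ℝ^d`. [folklore] -/
theorem contDiff_stLift_hubbardFreeSymbolTime :
    ContDiff ℝ ∞ (Literature.Analysis.FunctionSpaces.Torus.stLift
      (fun τ : ℝ => hubbardFreeSymbolTime (d := d) β μ (τ : ℂ))) := by
  have hfun : Literature.Analysis.FunctionSpaces.Torus.stLift
      (fun τ : ℝ => hubbardFreeSymbolTime (d := d) β μ (τ : ℂ)) =
      fun p : ℝ × EuclideanSpace ℝ (Fin d) =>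
        Complex.exp (-(p.1 : ℂ) * (((-2 * ∑ i, Real.cos (2 * Real.pi * p.2 i) - μ : ℝ)) : ℂ)) *
          ((fermiFunction β (-2 * ∑ i, Real.cos (2 * Real.pi * p.2 i) - μ) : ℝ) : ℂ) := by
    funext p
    rw [Literature.Analysis.FunctionSpaces.Torus.stLift_apply]
    exact hubbardFreeSymbolTime_coe β μ (p.1 : ℂ) (fun i => p.2 i)
  rw [hfun]
  have hband : ContDiff ℝ ∞ (fun p : ℝ × EuclideanSpace ℝ (Fin d) =>
      (-2 * ∑ i, Real.cos (2 * Real.pi * p.2 i) - μ : ℝ)) := by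
    refine ContDiff.sub (contDiff_const.mul (ContDiff.sum fun i _ => ?_)) contDiff_const
    exact Real.contDiff_cos.comp (contDiff_const.mul ((contDiff_piLp_apply 2).comp contDiff_snd))
  refine ContDiff.mul ?_ (Complex.ofRealCLM.contDiff.comp ((contDiff_fermiFunction β).comp hband))
  refine Complex.contDiff_exp.comp (ContDiff.mul ?_ (Complex.ofRealCLM.contDiff.comp hband))
  exact (Complex.ofRealCLM.contDiff.comp contDiff_fst).neg

/-- Hence the family `τ ↦ hubbardFreeSymbolTime β μ τ` (real `τ`) is a smooth space–time field on
every time set. [folklore] -/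
theorem isSmoothSpaceTimeOn_hubbardFreeSymbolTime (S : Set ℝ) :
    IsSmoothSpaceTimeOn S (fun τ : ℝ => hubbardFreeSymbolTime (d := d) β μ (τ : ℂ)) :=
  Literature.Analysis.FunctionSpaces.Torus.isSmoothSpaceTimeOn_of_contDiff
    (contDiff_stLift_hubbardFreeSymbolTime β μ) S

/-- **Uniform decay of the infinite-volume free propagator in the time separation**: for every
`T > 0` and every order `K` there is `C ≥ 0` with `|g(τ, z)| ≤ C (1 + |z|)^{-K}` for all real
`τ ∈ [0, T]` and all `z ∈ ℤ^d`. [cite: BenfattoGiulianiMastropietro2006, §2.2] -/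
theorem exists_uniform_decay_freePropagatorInfiniteTime {T : ℝ} (hT : 0 < T) (K : ℕ) :
    ∃ C : ℝ, 0 ≤ C ∧ ∀ τ ∈ Icc (0 : ℝ) T, ∀ z : Site d,
      ‖freePropagatorInfiniteTime (d := d) β μ (τ : ℂ) z‖ ≤ C * ((1 + ‖z‖) ^ K)⁻¹ := by
  obtain ⟨C, hC0, hC⟩ := Literature.Analysis.FluidPDE.ScalarFourier.exists_hasDecay_mFourierCoeff_spaceTime
    hT (isSmoothSpaceTimeOn_hubbardFreeSymbolTime (d := d) β μ (Icc 0 T)) K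
  refine ⟨C, hC0, fun τ hτ z => ?_⟩
  have := hC τ hτ (-z)
  rwa [norm_neg] at this

end Time

/-! ### Uniform decay in the volume -/

section Volume

variable (β μ : ℝ)

/-- **Uniform-in-`L` and uniform-in-time decay of the free torus propagator in the torus
distance**: for `β, μ, T > 0`, `K ≥ 4` there is `C ≥ 0` with
`|⟨a⁺_{xσ}(t) a⁻_{yσ'}(s)⟩_{β,L,U=0}| ≤ C (1 + |z|)^{-K}` for all `L ≥ 3`, real times with
`0 ≤ s - t ≤ T`, all `x, y, σ, σ'` and every representative `z ≡ y - x (mod L)` with `2|z| ≤ L`. [cite: BenfattoGiulianiMastropietro2006, §2.2] -/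
theorem exists_norm_hubbardThermalTwoPointEvolved_zero_interaction_le {T : ℝ} (hT : 0 < T)
    {K : ℕ} (hK : 4 ≤ K) :
    ∃ C : ℝ, 0 ≤ C ∧ ∀ (L : ℕ), 3 ≤ L → ∀ (t s : ℝ), s - t ∈ Icc (0 : ℝ) T →
      ∀ (x y z m : Site 2) (σ σ' : Fin 2), z = y - x + (L : ℤ) • m → 2 * ‖z‖ ≤ L →
        ‖hubbardThermalTwoPointEvolved β 0 μ L x σ (t : ℂ) y σ' (s : ℂ)‖ ≤ C * ((1 + ‖z‖) ^ K)⁻¹ := by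
  obtain ⟨C₀, hC₀, hdec⟩ := exists_uniform_decay_freePropagatorInfiniteTime (d := 2) β μ hT K
  have hS := summable_inv_one_add_norm_pow (d := 2) (K := K) (by omega)
  set S : ℝ := ∑' n : Site 2, ((1 + ‖n‖) ^ K)⁻¹ with hSdef
  have hS0 : 0 ≤ S := tsum_nonneg fun n => by positivity
  refine ⟨C₀ * (1 + (4 : ℝ) ^ K * S), by positivity, ?_⟩
  intro L hL t s hts x y z m σ σ' hz hzL
  rw [hubbardThermalTwoPointEvolved_zero_interaction_eq_tsum_images β μ hL x y σ σ']
  split_ifs with hσ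
  · rw [← tsum_translate_eq_of_eq_add_zsmul L m hz]
    have hτ : ((s : ℂ) - (t : ℂ)) = ((s - t : ℝ) : ℂ) := by push_cast; ring
    rw [hτ]
    exact norm_tsum_translate_le_of_decay hC₀ (hdec (s - t) hts) hS (by omega) hzL
  · rw [norm_zero]; positivity

/-- **The equal-time case**: for `β, μ`, `K ≥ 4` there is `C ≥ 0` with
`|⟨c†_{xσ} c_{yσ'}⟩_{β,L,U=0}| ≤ C (1 + |z|)^{-K}` for all `L ≥ 3`, `x, y, σ, σ'` and every
representative `z ≡ y - x (mod L)` with `2|z| ≤ L`. [cite: BenfattoGiulianiMastropietro2006, §2.2] -/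
theorem exists_norm_hubbardThermalTwoPoint_zero_interaction_le {K : ℕ} (hK : 4 ≤ K) :
    ∃ C : ℝ, 0 ≤ C ∧ ∀ (L : ℕ), 3 ≤ L → ∀ (x y z m : Site 2) (σ σ' : Fin 2),
      z = y - x + (L : ℤ) • m → 2 * ‖z‖ ≤ L →
        ‖hubbardThermalTwoPoint β 0 μ L x y σ σ'‖ ≤ C * ((1 + ‖z‖) ^ K)⁻¹ := by
  obtain ⟨C₀, hC₀, hdec⟩ := exists_decay_freePropagatorInfinite (d := 2) β μ K
  have hS := summable_inv_one_add_norm_pow (d := 2) (K := K) (by omega)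
  set S : ℝ := ∑' n : Site 2, ((1 + ‖n‖) ^ K)⁻¹ with hSdef
  have hS0 : 0 ≤ S := tsum_nonneg fun n => by positivity
  refine ⟨C₀ * (1 + (4 : ℝ) ^ K * S), by positivity, ?_⟩
  intro L hL x y z m σ σ' hz hzL
  rw [hubbardThermalTwoPoint_zero_interaction_eq_tsum_images β μ hL x y σ σ']
  split_ifs with hσ
  · rw [← tsum_translate_eq_of_eq_add_zsmul L m hz]
    exact norm_tsum_translate_le_of_decay hC₀ hdec hS (by omega) hzL
  · rw [norm_zero]; positivity

end Volume

/-! ### Arbitrary compact intervals of time separations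

The uniformity in the time separation is needed on `[-β, 0]` as well (in the perturbative
coefficients the creation time is the LATER one, BGM (1.4): `τ = x₀ - y₀ ≤ 0` up to the shift by
`β`), so we record the same statements for `τ` in an arbitrary compact interval `[a, b]`: the
space–time lift of the translated family `τ ↦ e^{-(τ + a)E} f_β(E)` is again `C^∞`. -/

section Interval

variable (β μ : ℝ)

/-- The time-translated free symbol `(τ, y) ↦ e^{-(τ+a)E(y)} f_β(E(y))` is jointly smooth. [folklore] -/
theorem contDiff_stLift_hubbardFreeSymbolTime_add (a : ℝ) :
    ContDiff ℝ ∞ (Literature.Analysis.FunctionSpaces.Torus.stLift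
      (fun τ : ℝ => hubbardFreeSymbolTime (d := d) β μ ((τ + a : ℝ) : ℂ))) := by
  have hfun : Literature.Analysis.FunctionSpaces.Torus.stLift
      (fun τ : ℝ => hubbardFreeSymbolTime (d := d) β μ ((τ + a : ℝ) : ℂ)) =
      Literature.Analysis.FunctionSpaces.Torus.stLift
        (fun τ : ℝ => hubbardFreeSymbolTime (d := d) β μ (τ : ℂ)) ∘
          fun p : ℝ × EuclideanSpace ℝ (Fin d) => (p.1 + a, p.2) := by
    funext p
    rfl
  rw [hfun]
  exact (contDiff_stLift_hubbardFreeSymbolTime β μ).comp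
    ((contDiff_fst.add contDiff_const).prodMk contDiff_snd)

/-- **Uniform decay of `g(τ, ·)` for `τ` in any compact interval**: for all real `a, b` and every
`K` there is `C ≥ 0` with `|g(τ, z)| ≤ C (1 + |z|)^{-K}` for all `τ ∈ [a, b]` and `z ∈ ℤ^d`. [cite: BenfattoGiulianiMastropietro2006, §2.2] -/
theorem exists_uniform_decay_freePropagatorInfiniteTime_Icc (a b : ℝ) (K : ℕ) :
    ∃ C : ℝ, 0 ≤ C ∧ ∀ τ ∈ Icc a b, ∀ z : Site d,
      ‖freePropagatorInfiniteTime (d := d) β μ (τ : ℂ) z‖ ≤ C * ((1 + ‖z‖) ^ K)⁻¹ := by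
  have hT : 0 < max (b - a) 0 + 1 := by positivity
  obtain ⟨C, hC0, hC⟩ := Literature.Analysis.FluidPDE.ScalarFourier.exists_hasDecay_mFourierCoeff_spaceTime
    hT (Literature.Analysis.FunctionSpaces.Torus.isSmoothSpaceTimeOn_of_contDiff
      (contDiff_stLift_hubbardFreeSymbolTime_add (d := d) β μ a) (Icc 0 (max (b - a) 0 + 1))) K
  refine ⟨C, hC0, fun τ hτ z => ?_⟩
  have hmem : τ - a ∈ Icc (0 : ℝ) (max (b - a) 0 + 1) :=
    ⟨by linarith [hτ.1], by linarith [hτ.2, le_max_left (b - a) 0]⟩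
  have h := hC (τ - a) hmem (-z)
  rw [norm_neg, show ((τ - a + a : ℝ) : ℂ) = (τ : ℂ) by push_cast; ring] at h
  exact h

/-- **Uniform-in-`L` decay of the free torus propagator for time separations in a compact
interval**: for `β, μ`, reals `a, b` and `K ≥ 4` there is `C ≥ 0` with
`|⟨a⁺_{xσ}(t) a⁻_{yσ'}(s)⟩_{β,L,U=0}| ≤ C (1 + |z|)^{-K}` for all `L ≥ 3`, real times with
`s - t ∈ [a, b]`, all `x, y, σ, σ'` and every representative `z ≡ y - x (mod L)` with `2|z| ≤ L`. [cite: BenfattoGiulianiMastropietro2006, §2.2] -/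
theorem exists_norm_hubbardThermalTwoPointEvolved_zero_interaction_le_of_Icc (a b : ℝ)
    {K : ℕ} (hK : 4 ≤ K) :
    ∃ C : ℝ, 0 ≤ C ∧ ∀ (L : ℕ), 3 ≤ L → ∀ (t s : ℝ), s - t ∈ Icc a b →
      ∀ (x y z m : Site 2) (σ σ' : Fin 2), z = y - x + (L : ℤ) • m → 2 * ‖z‖ ≤ L →
        ‖hubbardThermalTwoPointEvolved β 0 μ L x σ (t : ℂ) y σ' (s : ℂ)‖ ≤ C * ((1 + ‖z‖) ^ K)⁻¹ := by
  obtain ⟨C₀, hC₀, hdec⟩ := exists_uniform_decay_freePropagatorInfiniteTime_Icc (d := 2) β μ a b K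
  have hS := summable_inv_one_add_norm_pow (d := 2) (K := K) (by omega)
  set S : ℝ := ∑' n : Site 2, ((1 + ‖n‖) ^ K)⁻¹ with hSdef
  have hS0 : 0 ≤ S := tsum_nonneg fun n => by positivity
  refine ⟨C₀ * (1 + (4 : ℝ) ^ K * S), by positivity, ?_⟩
  intro L hL t s hts x y z m σ σ' hz hzL
  rw [hubbardThermalTwoPointEvolved_zero_interaction_eq_tsum_images β μ hL x y σ σ']
  split_ifs with hσ
  · rw [← tsum_translate_eq_of_eq_add_zsmul L m hz]
    have hτ : ((s : ℂ) - (t : ℂ)) = ((s - t : ℝ) : ℂ) := by push_cast; ring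
    rw [hτ]
    exact norm_tsum_translate_le_of_decay hC₀ (hdec (s - t) hts) hS (by omega) hzL
  · rw [norm_zero]; positivity

/-- **Every class has a short representative**: for `L ≥ 1` and `w ∈ ℤ^d` there are `z, m` with
`z = w + Lm` and `2|z| ≤ L` (reduce each coordinate into `(-L/2, L/2]`). [folklore] -/
theorem exists_representative_two_mul_norm_le {L : ℕ} (hL : 1 ≤ L) (w : Site d) :
    ∃ z m : Site d, z = w + (L : ℤ) • m ∧ 2 * ‖z‖ ≤ L := by
  -- coordinatewise: `z i = w i - L * round (w i / L)`-type choice via `Int.emod`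
  have hL0 : (0 : ℤ) < L := by exact_mod_cast hL
  -- centred residue of an integer
  have key : ∀ k : ℤ, ∃ r q : ℤ, r = k + L * q ∧ 2 * |r| ≤ L := by
    intro k
    by_cases h : 2 * (k % L) ≤ L
    · refine ⟨k % L, -(k / L), ?_, ?_⟩
      · have := Int.emod_add_mul_ediv k L; linarith [this]
      · rw [abs_of_nonneg (Int.emod_nonneg k hL0.ne')]; exact h
    · refine ⟨k % L - L, -(k / L) - 1, ?_, ?_⟩
      · have := Int.emod_add_mul_ediv k L; linarith [this]
      · have h1 : k % L < L := Int.emod_lt_of_pos k hL0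
        rw [abs_of_neg (by linarith)]
        push Not at h
        linarith
  choose r q hrq hr using key
  refine ⟨fun i => r (w i), fun i => q (w i), funext fun i => ?_, ?_⟩
  · simp only [Pi.add_apply, Pi.smul_apply, smul_eq_mul]
    exact hrq (w i)
  · -- `‖z‖ = sup |z i|`
    have h2 : ∀ i, 2 * |((r (w i) : ℤ) : ℝ)| ≤ L := fun i => by exact_mod_cast hr (w i)
    rcases Nat.eq_zero_or_pos d with hd | hd
    · subst hd
      have : (fun i : Fin 0 => r (w i)) = 0 := funext fun i => i.elim0
      rw [this, norm_zero, mul_zero]; positivity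
    · haveI : Nonempty (Fin d) := ⟨⟨0, hd⟩⟩
      obtain ⟨i, -, hi⟩ := Finset.exists_mem_eq_sup' Finset.univ_nonempty
        (fun i : Fin d => ‖((fun i => r (w i)) : Site d) i‖₊)
      have hnorm : ‖((fun i => r (w i)) : Site d)‖ = ‖(r (w i) : ℤ)‖ := by
        rw [Pi.norm_def]
        change ((Finset.univ.sup fun j : Fin d => ‖((fun i => r (w i)) : Site d) j‖₊ : NNReal) : ℝ) = _
        rw [← Finset.sup'_eq_sup Finset.univ_nonempty, hi, coe_nnnorm]
      rw [hnorm, Int.norm_eq_abs]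
      exact h2 i

/-- **Uniform-in-`L` decay in the torus distance, intrinsic form**: with `C` as in
`exists_norm_hubbardThermalTwoPointEvolved_zero_interaction_le_of_Icc`, for every `L ≥ 3`,
`s - t ∈ [a, b]`, sites `x, y` and spins, there is a representative `z ≡ y - x (mod L)` with
`2|z| ≤ L` and `|⟨a⁺_{xσ}(t) a⁻_{yσ'}(s)⟩_{β,L,U=0}| ≤ C (1 + |z|)^{-K}`. [cite: BenfattoGiulianiMastropietro2006, §2.2] -/
theorem exists_norm_hubbardThermalTwoPointEvolved_zero_interaction_le_of_Icc' (a b : ℝ)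
    {K : ℕ} (hK : 4 ≤ K) :
    ∃ C : ℝ, 0 ≤ C ∧ ∀ (L : ℕ), 3 ≤ L → ∀ (t s : ℝ), s - t ∈ Icc a b →
      ∀ (x y : Site 2) (σ σ' : Fin 2), ∃ z m : Site 2, z = y - x + (L : ℤ) • m ∧ 2 * ‖z‖ ≤ L ∧
        ‖hubbardThermalTwoPointEvolved β 0 μ L x σ (t : ℂ) y σ' (s : ℂ)‖ ≤ C * ((1 + ‖z‖) ^ K)⁻¹ := by
  obtain ⟨C, hC0, hC⟩ := exists_norm_hubbardThermalTwoPointEvolved_zero_interaction_le_of_Icc β μ a b hK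
  refine ⟨C, hC0, fun L hL t s hts x y σ σ' => ?_⟩
  obtain ⟨z, m, hz, hzL⟩ := exists_representative_two_mul_norm_le (d := 2) (L := L) (by omega) (y - x)
  exact ⟨z, m, hz, hzL, hC L hL t s hts x y z m σ σ' hz hzL⟩

end Interval

end Literature.MathematicalPhysics.QuantumLattice

end
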